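import Summits.BirchSwinnertonDyer.BirchSwinnertonDyer.Theses.ByReductionTypeAtTwo
import Summits.BirchSwinnertonDyer.BirchSwinnertonDyer.Theorems.ByReductionTypeAtTwoMultLowerHalfInputs
import Summits.BirchSwinnertonDyer.Rank1Residual.X5.TwoAdicTargetsMultPubOdd
import HarnessLib

/-!
# Route `ByReductionTypeAtTwo`, layer-2 child `MultLowerHalfAtTwo` (item stmt-BirchSwinnertonDyer-19923):
# the Theorems-side bridges RE-TYPED on the guarded twin of Greenberg's non-split display (audit N-1)

Twin of `Theorems/ByReductionTypeAtTwoMultLowerHalfInputs.lean` (p418911, seat bsd-2adic-mult-3 GEN 0).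
Every theorem there displays the PRINT binder `(h41ns : A235)`,
A235 = `Greenberg1999.thm41Analogue_charValue_rankZero_numberField_anyPrime` (parity-free, `l_v = 2` at
EVERY non-split multiplicative `v ∣ 2` of EVERY number field). The cell's D-audit of that binder
(bsd-2adic-audit-1 GEN 3, `HOME/audit/D-AUDIT-h41-Gr99-Thm41-mult-analogue-at-2.md` @f526883ecb786716,
verdict V2) found A235 CONTRADICTED by its own source as a `∀ F` statement (LNM 1716 §3 Note, held copy
`book:coates1999-arithmetic-theory-elliptic-curves` chunk p0093 L15: when `(F_∞)_η ⊇ F_v^{unr}`-quadratic,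
e.g. `F = ℚ(√10)` at `v ∣ 2`, `|ker(r_v)| ≤ 1`), so `(h41ns : A235)` risks vacuity and no row may be worded
PROVED-by-name on it. Remedy (audit N-1(b)): re-type the binder to the guarded twin
`…_anyPrime_oddLocalDegree` (p425330; print's generic case, automatic over `ℚ`; its `….nonsplit_two` has
the SAME statement as A235's), through the primed O1 glue
`X5.O1.twoAdicEulerCharRankZeroNonsplitMult_zero_of_greenberg'` (p428013,
`X5/TwoAdicTargetsMultPubOdd.lean`). This file lands the primed bridges, each with the FULLY-QUALIFIED
route decl as conclusion and EVERY other binder unchanged: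

* `missingLowerBoundAt_two_of_multEisenstein_of_greenberg'_of_multRat` — per pair (twin of
  `X5.O1.missingLowerBoundAt_two_of_multEisenstein_of_greenberg_of_multRat`, p418075);
* `multLowerHalfAtTwo_of_multEisenstein'` — item 19923 ⟸ PRINT {twin, A236, modularity, GZK} + MEMO
  {Kato `⊗ℚ` clause (1), GS@2} + ∀ T-mult-4-int `X5.O1.MultEisensteinDivisibilityAtTwo`;
* `multiplicativeRankZeroAtTwo_of_muRoad'` — twin of the parent's `μ = 0` road
  `multiplicativeRankZeroAtTwo_of_muRoad` (p409679, bsd-2adic-mult), routed through the hEC-level doors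
  `X5.O1.bsdp_two_nonsplit_of_mu_eq_zero_of_lowerBound_auto`'s body
  (`missingUpperBoundAt_two_nonsplit_of_mu_eq_zero_auto` with the primed glue); split branch unchanged
  (A236 is not affected by the audit);
* `multiplicativeRankZeroAtTwo_of_muRoad_of_multEisenstein'` — the road with `hlow` discharged by
  T-mult-4-int, on the twin.

The unprimed theorems stay (append-only tree) and are DERIVED from these (A235 → twin,
`…_oddLocalDegree_of_anyPrime`). HONEST FRAMING (cell bsd-2adic, seat bsd-2adic-mult-3 GEN 3):
COMPOSITION certificates; every research input stays a hypothesis; the item is NOT closed (T-mult-4-int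
is OPEN at `p = 2`); no class is closed here; BSD is not proved by any of this. PARTITION: X5@2 mult
(K4ᵐ, RESIDUAL-MAP B1·O1; 1 976 book230 classes) × p = 2 — types-the-object-of (item 19923; PRINT
binder hygiene); closes none. [cite: GreenbergLNM1716, §4 pp. 112–113 and §3]
[cite: Miller2011LMS, Def 1.1] [cite: Kato2004Asterisque, Thm. 17.4 (1) (p. 273; shape at p ∣ N)]
-/

set_option autoImplicit false
-- the route's Theorems namespace `Summit.BirchSwinnertonDyer.BirchSwinnertonDyer.Theorems` repeats a
-- component by design (summit = sub-problem, D-0017); same justification as p409679 / p418911.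
set_option linter.dupNamespace false

noncomputable section

open scoped Classical MatrixGroups ModularForm

open CongruenceSubgroup WeierstrassCurve Literature.NumberTheory.EllipticCurves
  Literature.NumberTheory.EllipticCurves.ModularForms
  Literature.NumberTheory.EllipticCurves.Greenberg1999
  Literature.NumberTheory.EllipticCurves.Rank1Residual
  Literature.NumberTheory.EllipticCurves.Rank1Residual.Typed
  Summit.BirchSwinnertonDyer.Rank1Residual.X5

namespace Summit.BirchSwinnertonDyer.BirchSwinnertonDyer.Theorems

/-! ## §1 Per pair: the lower half on «r_an = 0, Mult@2» from PRINT (twin) + MEMO + T-mult-4-int -/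

/-- **The per-pair LOWER half on «r_an = 0, Mult@2» from PRINT + MEMO + T-mult-4-int, on the twin
(PROVED).** Twin of `X5.O1.missingLowerBoundAt_two_of_multEisenstein_of_greenberg_of_multRat` with the
non-split display fed by the GUARDED fact `…_anyPrime_oddLocalDegree` (`h41ns`) through the primed glue;
the split display A236 (`h41sp`), `X` torsion from the prime-uniform Kato binder (clause (1)),
modularity, GZK, Greenberg–Stevens at a split `2` (`hGS`) and the ONE research object
`MultEisensteinDivisibilityAtTwo W` are unchanged. [cite: GreenbergLNM1716, §4 pp. 112–113 and §3]
[cite: Kato2004Asterisque, Thm. 17.4 (1) (p. 273)] [cite: Miller2011LMS, Def. 1.1 and §1] -/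
theorem missingLowerBoundAt_two_of_multEisenstein_of_greenberg'_of_multRat
    (W : WeierstrassCurve ℚ) [W.IsElliptic] [W.IsGloballyMinimal]
    (h41ns : thm41Analogue_charValue_rankZero_numberField_anyPrime_oddLocalDegree)
    (h41sp : thm41Analogue_charValue_rankZero_split_baseChange_anyPrime)
    (hmod : nonempty_modularParametrizationData)
    (hGZK : rank_eq_analyticRank_of_analyticRank_le_one)
    (hKato : O1.KatoMultiplicativeDivisibilityRat W 2)
    (hGS : W.HasSplitMultiplicativeReductionAtPrime 2 → greenberg_stevens (W := W) (p := 2))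
    (hr : W.analyticRank = 0) (hmult : Mult W 2) (h : O1.MultEisensteinDivisibilityAtTwo W) :
    MissingLowerBoundAt W 2 := by
  haveI : NeZero (W.conductorNorm ℤ) := ⟨(W.conductorNorm_pos_holds).ne'⟩
  obtain ⟨Dm⟩ := hmod W
  have hf : IsNewformOf W Dm.f := Dm.isNewformOf
  exact O1.missingLowerBoundAt_two_of_multEisenstein W
    (O1.twoAdicEulerCharRankZeroNonsplitMult_zero_of_greenberg' W h41ns)
    (O1.twoAdicEulerCharRankZeroSplitMult_zero_of_greenberg W h41sp) hmod hGZK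
    (fun κ γ hκ hγ hγ' D => (hKato κ γ hκ hγ hγ' hmult Dm.f hf D).1) hGS hr hmult h

/-! ## §2 The route decls on the twin -/

/-- **Bridge (T-mult-4-int ⇒ the lower half, item 19923) on the twin.** Twin of
`multLowerHalfAtTwo_of_multEisenstein` (p418911) with `h41ns` re-typed to `…_anyPrime_oddLocalDegree`:
PRINT {the guarded Thm-4.1 analogue at a non-split multiplicative prime (`h41ns`), A236 (`h41sp`),
modularity (`hmod`), GZK (`hGZK`)} + MEMO {Kato `⊗ℚ` at a multiplicative `2` (`hKato`; only `X`
torsion is used), Greenberg–Stevens at a split `2` (`hGS`)} + the ONE research object T-mult-4-int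
∀-closed over non-CM `E/ℚ` of analytic rank `0` multiplicative at `2` (`hE`) imply the route's child
`MultLowerHalfAtTwo`. Composition certificate; nothing asserted; the item stays OPEN with T-mult-4-int.
[cite: GreenbergLNM1716, §4 pp. 112–113 and §3] [cite: Miller2011LMS, Def 1.1] -/
theorem multLowerHalfAtTwo_of_multEisenstein'
    (h41ns : thm41Analogue_charValue_rankZero_numberField_anyPrime_oddLocalDegree)
    (h41sp : thm41Analogue_charValue_rankZero_split_baseChange_anyPrime)
    (hmod : nonempty_modularParametrizationData)
    (hGZK : rank_eq_analyticRank_of_analyticRank_le_one)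
    (hKato : ∀ (W : WeierstrassCurve ℚ) [W.IsElliptic] [W.IsGloballyMinimal],
      ¬ W.HasCM → Mult W 2 → O1.KatoMultiplicativeDivisibilityRat W 2)
    (hGS : ∀ (W : WeierstrassCurve ℚ) [W.IsElliptic] [W.IsGloballyMinimal],
      W.HasSplitMultiplicativeReductionAtPrime 2 → greenberg_stevens (W := W) (p := 2))
    (hE : ∀ (W : WeierstrassCurve ℚ) [W.IsElliptic] [W.IsGloballyMinimal],
      ¬ W.HasCM → W.analyticRank = 0 → Mult W 2 → O1.MultEisensteinDivisibilityAtTwo W) :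
    Summit.BirchSwinnertonDyer.BirchSwinnertonDyer.Theses.ByReductionTypeAtTwo.MultLowerHalfAtTwo := by
  unfold Summit.BirchSwinnertonDyer.BirchSwinnertonDyer.Theses.ByReductionTypeAtTwo.MultLowerHalfAtTwo
  intro W _ _ hcm hr hmult
  exact missingLowerBoundAt_two_of_multEisenstein_of_greenberg'_of_multRat W h41ns h41sp hmod hGZK
    (hKato W hcm hmult) (hGS W) hr hmult (hE W hcm hr hmult)

/-- **The parent's `μ = 0` road on the twin.** Twin of `multiplicativeRankZeroAtTwo_of_muRoad` (p409679,
seat bsd-2adic-mult) with `h41ns` re-typed to `…_anyPrime_oddLocalDegree`: ∀-closed over the class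
«non-CM, analytic rank `0`, multiplicative at `2`», PRINT {`h41ns` (guarded), `h41sp`, `hmod`, `hGZK`} +
MEMO {`hKato` (RC-2), `hGS` (RC-4, converted to `hκ₁` by `O1.kappaOne_of_greenbergStevens`)} + the
OPEN class-wide objects {`hμ` : `μ(X(E/ℚ_∞)) = 0` for every cyclotomic dual datum, `hper₀` :
`0 ≤ ord₂ ϖ`, `hlow` : the lower half} give the crux `MultiplicativeRankZeroAtTwo`. Non-split branch:
the hEC-level door `O1.missingUpperBoundAt_two_nonsplit_of_mu_eq_zero_auto` fed by the primed glue,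
then the two halves make `BSDp W 2` (`bsdp_of_missingPPartAt`); split branch verbatim
(`O1.bsdp_two_split_of_mu_eq_zero_of_lowerBound_of_multRat`, A236 untouched by the audit).
Composition certificate; nothing asserted. [cite: Kato2004Asterisque, Thm 17.4 and 17.13 (shape)]
[cite: GreenbergLNM1716, §4 pp. 112–113 and §3] [cite: Kobayashi2006DocMath, Cor 4.2]
[cite: Miller2011LMS, Def 1.1] -/
theorem multiplicativeRankZeroAtTwo_of_muRoad'
    (hKato : ∀ (W : WeierstrassCurve ℚ) [W.IsElliptic] [W.IsGloballyMinimal],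
      ¬ W.HasCM → Mult W 2 → O1.KatoMultiplicativeDivisibilityRat W 2)
    (h41ns : thm41Analogue_charValue_rankZero_numberField_anyPrime_oddLocalDegree)
    (h41sp : thm41Analogue_charValue_rankZero_split_baseChange_anyPrime)
    (hmod : nonempty_modularParametrizationData)
    (hGZK : rank_eq_analyticRank_of_analyticRank_le_one)
    (hGS : ∀ (W : WeierstrassCurve ℚ) [W.IsElliptic] [W.IsGloballyMinimal],
      W.HasSplitMultiplicativeReductionAtPrime 2 → greenberg_stevens (W := W) (p := 2))
    (hμ : ∀ (W : WeierstrassCurve ℚ) [W.IsElliptic] [W.IsGloballyMinimal],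
      ¬ W.HasCM → W.analyticRank = 0 → Mult W 2 →
      ∀ (κ : ZpExtension ℚ 2) (γ : Field.absoluteGaloisGroup ℚ), κ.IsCyclotomic →
        κ.IsTopGenerator γ → IsCyclotomicVariable 2 γ → ∀ D : W.SelmerDualData κ γ, D.mu = 0)
    (hper₀ : ∀ (W : WeierstrassCurve ℚ) [W.IsElliptic] [W.IsGloballyMinimal],
      ¬ W.HasCM → W.analyticRank = 0 → Mult W 2 →
      ∀ [NeZero (W.conductorNorm ℤ)] (f : CuspForm (Gamma0 (W.conductorNorm ℤ)) 2),
        IsNewformOf W f → ∀ ϖ : ℚ, (ϖ : ℝ) * W.realPeriodRat = plusPeriod f → 0 ≤ padicValRat 2 ϖ)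
    (hlow : ∀ (W : WeierstrassCurve ℚ) [W.IsElliptic] [W.IsGloballyMinimal],
      ¬ W.HasCM → W.analyticRank = 0 → Mult W 2 → MissingLowerBoundAt W 2) :
    Summit.BirchSwinnertonDyer.BirchSwinnertonDyer.Theses.ByReductionTypeAtTwo.MultiplicativeRankZeroAtTwo := by
  unfold Summit.BirchSwinnertonDyer.BirchSwinnertonDyer.Theses.ByReductionTypeAtTwo.MultiplicativeRankZeroAtTwo
  intro W _ _ hcm hr hmult
  haveI : Fact (Nat.Prime 2) := ⟨Nat.prime_two⟩
  by_cases hsp : W.HasSplitMultiplicativeReductionAtPrime 2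
  · exact O1.bsdp_two_split_of_mu_eq_zero_of_lowerBound_of_multRat W (hKato W hcm hmult) h41sp hmod
      hGZK (hμ W hcm hr hmult)
      (fun f hf L hL Dq => O1.kappaOne_of_greenbergStevens W (hGS W hsp) hr hf hL Dq)
      (hper₀ W hcm hr hmult) hr hmult hsp (hlow W hcm hr hmult)
  · exact bsdp_of_missingPPartAt W 2 hGZK (by rw [hr]; exact zero_le_one)
      (missingPPartAt_of_lower_of_upper W 2 (hlow W hcm hr hmult)
        (O1.missingUpperBoundAt_two_nonsplit_of_mu_eq_zero_auto W
          (O1.twoAdicEulerCharRankZeroNonsplitMult_zero_of_greenberg' W h41ns) hmod hGZK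
          (fun f L => O1.katoDivisibilityAtTwoNonsplitMultRat_of_multRat W (hKato W hcm hmult) f L)
          (hμ W hcm hr hmult) (hper₀ W hcm hr hmult) hr hmult hsp))

/-- **Bridge (the `μ = 0` road with `hlow` DISCHARGED by T-mult-4-int ⇒ crux) on the twin.** Twin of
`multiplicativeRankZeroAtTwo_of_muRoad_of_multEisenstein` (p418911): on this road the crux
`MultiplicativeRankZeroAtTwo` has exactly three typed class-wide research inputs {`μ = 0`, `0 ≤ ord₂ ϖ`,
T-mult-4-int} over PRINT {`h41ns` (guarded twin), `h41sp`, `hmod`, `hGZK`} + MEMO {`hKato`, `hGS`} and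
no untyped binder. Composition certificate; nothing asserted.
[cite: Kato2004Asterisque, Thm 17.4 and 17.13 (shape)] [cite: GreenbergLNM1716, §4 pp. 112–113 and §3]
[cite: Miller2011LMS, Def 1.1] -/
theorem multiplicativeRankZeroAtTwo_of_muRoad_of_multEisenstein'
    (hKato : ∀ (W : WeierstrassCurve ℚ) [W.IsElliptic] [W.IsGloballyMinimal],
      ¬ W.HasCM → Mult W 2 → O1.KatoMultiplicativeDivisibilityRat W 2)
    (h41ns : thm41Analogue_charValue_rankZero_numberField_anyPrime_oddLocalDegree)
    (h41sp : thm41Analogue_charValue_rankZero_split_baseChange_anyPrime)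
    (hmod : nonempty_modularParametrizationData)
    (hGZK : rank_eq_analyticRank_of_analyticRank_le_one)
    (hGS : ∀ (W : WeierstrassCurve ℚ) [W.IsElliptic] [W.IsGloballyMinimal],
      W.HasSplitMultiplicativeReductionAtPrime 2 → greenberg_stevens (W := W) (p := 2))
    (hμ : ∀ (W : WeierstrassCurve ℚ) [W.IsElliptic] [W.IsGloballyMinimal],
      ¬ W.HasCM → W.analyticRank = 0 → Mult W 2 →
      ∀ (κ : ZpExtension ℚ 2) (γ : Field.absoluteGaloisGroup ℚ), κ.IsCyclotomic →
        κ.IsTopGenerator γ → IsCyclotomicVariable 2 γ → ∀ D : W.SelmerDualData κ γ, D.mu = 0)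
    (hper₀ : ∀ (W : WeierstrassCurve ℚ) [W.IsElliptic] [W.IsGloballyMinimal],
      ¬ W.HasCM → W.analyticRank = 0 → Mult W 2 →
      ∀ [NeZero (W.conductorNorm ℤ)] (f : CuspForm (Gamma0 (W.conductorNorm ℤ)) 2),
        IsNewformOf W f → ∀ ϖ : ℚ, (ϖ : ℝ) * W.realPeriodRat = plusPeriod f → 0 ≤ padicValRat 2 ϖ)
    (hE : ∀ (W : WeierstrassCurve ℚ) [W.IsElliptic] [W.IsGloballyMinimal],
      ¬ W.HasCM → W.analyticRank = 0 → Mult W 2 → O1.MultEisensteinDivisibilityAtTwo W) :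
    Summit.BirchSwinnertonDyer.BirchSwinnertonDyer.Theses.ByReductionTypeAtTwo.MultiplicativeRankZeroAtTwo := by
  have hlow := multLowerHalfAtTwo_of_multEisenstein' h41ns h41sp hmod hGZK hKato hGS hE
  unfold Summit.BirchSwinnertonDyer.BirchSwinnertonDyer.Theses.ByReductionTypeAtTwo.MultLowerHalfAtTwo
    at hlow
  exact multiplicativeRankZeroAtTwo_of_muRoad' hKato h41ns h41sp hmod hGZK hGS hμ hper₀ hlow

end Summit.BirchSwinnertonDyer.BirchSwinnertonDyer.Theorems

end
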